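import Literature.AlgebraicGeometry.Frobenioids.PadicKummerGaloisChartRelCoset
import Literature.AlgebraicGeometry.Frobenioids.PadicKummerIsoOfFunctorKer
import HarnessLib

/-!
# Frobenioids II, Theorem 2.4 (i) for the `p`-adic Frobenioids over GENERAL bases `B^temp(Π, Π°)⁰` of §2 themselves
# (row (α), file D5 over a general `Π → G_{ℚ_p}`)

Mochizuki, *The geometry of Frobenioids II*, Kyushu J. Math. **62** (2008) 401–460, §2, Theorem 2.4 pp. 19–20
[cite: MochizukiFrdII2008, Thm 2.4 (i) p.19]: "For `i = 1, 2`, let `pᵢ ∈ Primes`; `Cᵢ` a `pᵢ`-adic Frobenioid … whose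
base category `Dᵢ` satisfies `Dᵢ = B^temp(Πᵢ, Πᵢ°)⁰` [cf. Example 1.3, (iii)], where `Πᵢ → Qᵢ := G_{ℚ_{pᵢ}}` is an open
homomorphism of temp-slim tempered topological groups …; `Gᵢ := Im(Πᵢ) ⊆ Qᵢ` …. Suppose further that we have been
given open normal subgroups `H₁ ⊆ G₁`, `H₂ ⊆ G₂`, together with an equivalence of categories `Ψ : C₁ ⥲ C₂` — which …
necessarily induces a 1-compatible equivalence of categories `Ψ_Base : D₁ ⥲ D₂`, hence an outer isomorphism … `Π₁ ⥲ Π₂` … that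
lies over an outer isomorphism … `G₁ ⥲ G₂` …. Assume that this isomorphism `G₁ ⥲ G₂` maps `H₁` onto `H₂`. Then …
(i) … `p₁ = p₂`; `Ψ` maps `(N, H₁)`-saturated objects to `(N, H₂)`-saturated objects and induces isomorphisms … which
are compatible with the respective Kummer and reciprocity maps".

Sequel to abc-iut-L1-t7's files D1–D5 (GAP row G-L1t7-α, `Π = G_{ℚ_p}`) and to the general-base chart files
`PadicKummerRelCosetGaloisFields.lean` / `PadicKummerGaloisChartRelCoset.lean` / `PadicKummerIsoOfFunctorKer.lean`
(seat abc-iut-L1-t7, gen 5). For `Ψ : C₁ ⥤ C₂` fully faithful between `pᵢ`-adic Frobenioids over GENERAL §2 bases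
`hdᵢ : dᵢ.base = relBaseGal pᵢ Πᵢ° φᵢ hφᵢ` (`φᵢ : Πᵢ → G_{ℚ_{pᵢ}}` any open homomorphisms) and an object `A₁` with
`(A₁)_D`, `(Ψ A₁)_D` Galois, this file CONSTRUCTS the isomorphism of the Definition 2.2 contexts of `A₁` and `Ψ A₁`
induced by `Ψ` (`isoOfFunctorRel`) and derives **`thm24i_ofFunctorRel`: Theorem 2.4 (i) in the printed generality of
the base**, modulo EXACTLY the printed named inputs:
(hO) "`Ψ` preserves `O^⊳(−)`" ([FrdI] Cor. 4.10/4.11, row L02);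
(hbase) "`Ψ_Base` lies over `G₁ ⥲ G₂`" AT `A₁`, in the kernel form the construction uses: `Base(α⁻¹)` pushes forward to
  the identity of `(A₁)_E` iff `Base((Ψα)⁻¹)` pushes forward to the identity of `(Ψ A₁)_E` (for `Π = G_{ℚ_p}` this was
  automatic, file D3b; here `Ker(Aut_C(A) → Aut_E(A_E)) ⊋ O^×(A)`, `resK_eq_one_iff`);
(isoG, houter, map_H) the outer isomorphism `G₁ ⥲ G₂` of the ABSOLUTE GALOIS GROUPS of `Kᵢ = ℚ̄_{pᵢ}^{Im(Πᵢ)}`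
  carrying `H₁` onto `H₂`, compatible with `Ψ` on automorphisms;
(hfs) "`Φ₁` fieldwise saturated iff `Φ₂`" (row L03).
Non-vacuity of the hypotheses `hdᵢ`/`hAᵢ`: `contextOfObjectRel_zero_AutC`.

HONEST SCOPE (what is constructed here vs what [FrdII] Thm. 2.4 (i) asserts). CONSTRUCTED/PROVED: the charts, the
descended actions, `Aut_C(Aᵢ) ↠ Gal(K_{Aᵢ}/Kᵢ)` with its kernel and surjectivity, the context isomorphism from `Ψ`, the
identifications `μ_N(Aᵢ) ≅ μ_N(K̄ᵢ)`, "`p₁ = p₂`", local Tate duality over `Kᵢ`, the saturation transfer, and the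
Kummer/reciprocity/action compatibilities (abc-iut-L1-t7/L1-d4/L2-t12 Galois-binding theorems). TAKEN AS NAMED INPUTS,
exactly as print takes them from elsewhere: (a) "`Ψ` preserves `O^⊳(−)`" (`hO`; print: [FrdI] Cor. 4.10, 4.11 (ii)(iii) via
"rationally standard over a slim base"); (b) the outer isomorphism `G₁ ⥲ G₂` over which `Ψ_Base` lies, carrying `H₁` onto
`H₂` (`isoG`, `houter`, `map_H`, and its kernel shadow `hbase`; print: [Mzk2] Prop. 3.2 / Thm. A.4 temp-slimness and
Thm. 1.2 (ii) — the anabelian step, NOT formalised here); (c) "`Φ₁` fieldwise saturated iff `Φ₂`" (`hfs`, row L03);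
(d) `(Ψ A₁)_D` Galois (`hA₂`; in print automatic from the equivalence `Ψ_Base`). No input is a restatement of the
conclusion. Nothing here concerns [IUTchIII]; classical.
-/

noncomputable section

namespace Literature.AlgebraicGeometry.Frobenioids

namespace PadicKummer.Def22Context

open CategoryTheory Field IntermediateField Kummer Function
open Literature.NumberTheory.GaloisRepresentations
open Literature.AnabelianGeometry.SemiGraphs QuasiTemperoid PadicFrd PadicFrd.Datum PadicFrd.Datum.GaloisChart PadicFrd.RelGal

variable {p₁ p₂ : ℕ} [Fact p₁.Prime] [Fact p₂.Prime]
  {P₁ : Type} [Group P₁] [TopologicalSpace P₁] {φ₁ : P₁ →* GalFbar ℚ_[p₁]} {hφ₁ : IsOpenHom φ₁} {P₁₀ : OpenSubgroup P₁}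
  {d₁ : PadicFrd.Datum (RelCosetCat P₁₀) p₁} (hd₁ : d₁.base = relBaseGal p₁ P₁₀ φ₁ hφ₁)
  {P₂ : Type} [Group P₂] [TopologicalSpace P₂] {φ₂ : P₂ →* GalFbar ℚ_[p₂]} {hφ₂ : IsOpenHom φ₂} {P₂₀ : OpenSubgroup P₂}
  {d₂ : PadicFrd.Datum (RelCosetCat P₂₀) p₂} (hd₂ : d₂.base = relBaseGal p₂ P₂₀ φ₂ hφ₂)
  (F : d₁.frobenioid ⥤ d₂.frobenioid) [F.Full] [F.Faithful] {A₁ : d₁.frobenioid}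
  (hA₁ : A₁.base.obj.sg.toSubgroup.Normal) (hA₂ : (F.obj A₁).base.obj.sg.toSubgroup.Normal)

/-- **`hbase` ⇒ `hkerF`**: if `Ψ_Base` carries the automorphisms of `(A₁)_D` that are trivial on `(A₁)_E` exactly onto
those of `(Ψ A₁)_D` trivial on `(Ψ A₁)_E`, then `Ψ` carries `Ker(Aut_{C₁}(A₁) → Aut_{E₁})` onto
`Ker(Aut_{C₂}(Ψ A₁) → Aut_{E₂})` for the charts `galoisChartRel` (`galoisChartRel_res_eq_one_iff`).
[cite: MochizukiFrdII2008, Thm 2.4 (i) p.19] -/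
theorem res_eq_one_iff_autEquiv_of_push
    (hbase : ∀ α : Aut A₁,
      (CosetCat.push φ₁ hφ₁.isOpenMap).map (ModelFrobenioid.baseMap α.inv).hom = 𝟙 _ ↔
        (CosetCat.push φ₂ hφ₂.isOpenMap).map (ModelFrobenioid.baseMap (F.mapIso α).inv).hom = 𝟙 _)
    (α : Aut A₁) :
    (galoisChartRel φ₁ hφ₁ d₁ hd₁ A₁ hA₁).res α = 1 ↔
      (galoisChartRel φ₂ hφ₂ d₂ hd₂ (F.obj A₁) hA₂).res (autEquiv F α) = 1 := by
  rw [galoisChartRel_res_eq_one_iff, autEquiv_apply, galoisChartRel_res_eq_one_iff]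
  exact hbase α

variable (hO : ∀ f : A₁ ⟶ A₁, f ∈ PreFrobenioid.endSubmonoid d₁.structureFunctor A₁ ↔
    F.map f ∈ PreFrobenioid.endSubmonoid d₂.structureFunctor (F.obj A₁))
  (hbase : ∀ α : Aut A₁,
    (CosetCat.push φ₁ hφ₁.isOpenMap).map (ModelFrobenioid.baseMap α.inv).hom = 𝟙 _ ↔
      (CosetCat.push φ₂ hφ₂.isOpenMap).map (ModelFrobenioid.baseMap (F.mapIso α).inv).hom = 𝟙 _)
  {H₁ : Subgroup (absoluteGaloisGroup (baseFld p₁ φ₁ hφ₁))} [H₁.Normal]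
  {hH₁ : IsOpen (H₁ : Set (absoluteGaloisGroup (baseFld p₁ φ₁ hφ₁)))}
  {H₂ : Subgroup (absoluteGaloisGroup (baseFld p₂ φ₂ hφ₂))} [H₂.Normal]
  {hH₂ : IsOpen (H₂ : Set (absoluteGaloisGroup (baseFld p₂ φ₂ hφ₂)))}
  (isoG : absoluteGaloisGroup (baseFld p₁ φ₁ hφ₁) ≃ₜ* absoluteGaloisGroup (baseFld p₂ φ₂ hφ₂))
  (houter : haveI := normal_objL φ₁ hφ₁ d₁ A₁ hA₁; haveI := normal_objL φ₂ hφ₂ d₂ (F.obj A₁) hA₂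
    ∀ g : absoluteGaloisGroup (baseFld p₁ φ₁ hφ₁), resGal (objL φ₂ hφ₂ d₂ (F.obj A₁)) (isoG g) =
      galEquivKer F (galoisChartRel φ₁ hφ₁ d₁ hd₁ A₁ hA₁) (galoisChartRel φ₂ hφ₂ d₂ hd₂ (F.obj A₁) hA₂)
        (res_eq_one_iff_autEquiv_of_push hd₁ hd₂ F hA₁ hA₂ hbase) (resGal (objL φ₁ hφ₁ d₁ A₁) g))
  (map_H : H₁.map isoG.toMulEquiv.toMonoidHom = H₂)
  (N : ℕ) [NeZero N]
  (hμ₁ : ∀ ζ : rootsOfUnity N (AlgebraicClosure (baseFld p₁ φ₁ hφ₁)),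
    ((ζ : (AlgebraicClosure (baseFld p₁ φ₁ hφ₁))ˣ) : AlgebraicClosure (baseFld p₁ φ₁ hφ₁)) ∈ objL φ₁ hφ₁ d₁ A₁)
  (hμ₂ : ∀ ζ : rootsOfUnity N (AlgebraicClosure (baseFld p₂ φ₂ hφ₂)),
    ((ζ : (AlgebraicClosure (baseFld p₂ φ₂ hφ₂))ˣ) : AlgebraicClosure (baseFld p₂ φ₂ hφ₂)) ∈ objL φ₂ hφ₂ d₂ (F.obj A₁))
  [LocallyCompactSpace (contextOfObjectRel φ₁ hφ₁ d₁ hd₁ A₁ hA₁ H₁ hH₁).H]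
  [LocallyCompactSpace (contextOfObjectRel φ₂ hφ₂ d₂ hd₂ (F.obj A₁) hA₂ H₂ hH₂).H]

/-- **The isomorphism of the Definition 2.2 contexts of `A₁` and `Ψ A₁` induced by `Ψ`, over GENERAL §2 bases**
(`isoOfFunctorKer` at the charts `galoisChartRel`; the kernel hypothesis discharged from `hbase`, the Galois clause by
`isGalois_objL`). [cite: MochizukiFrdII2008, Thm 2.4 (i) p.19] -/
def isoOfFunctorRel :
    (contextOfObjectRel φ₁ hφ₁ d₁ hd₁ A₁ hA₁ H₁ hH₁).Iso (contextOfObjectRel φ₂ hφ₂ d₂ hd₂ (F.obj A₁) hA₂ H₂ hH₂) :=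
  haveI := finiteDimensional_objL φ₁ hφ₁ d₁ A₁; haveI := normal_objL φ₁ hφ₁ d₁ A₁ hA₁
  haveI := finiteDimensional_objL φ₂ hφ₂ d₂ (F.obj A₁); haveI := normal_objL φ₂ hφ₂ d₂ (F.obj A₁) hA₂
  isoOfFunctorKer F (galoisChartRel φ₁ hφ₁ d₁ hd₁ A₁ hA₁) (galoisChartRel φ₂ hφ₂ d₂ hd₂ (F.obj A₁) hA₂) hO
    (res_eq_one_iff_autEquiv_of_push hd₁ hd₂ F hA₁ hA₂ hbase) H₁ hH₁ H₂ hH₂ isoG houter map_H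
    ⟨fun _ => isGalois_objL φ₂ hφ₂ d₂ (F.obj A₁) hA₂, fun _ => isGalois_objL φ₁ hφ₁ d₁ A₁ hA₁⟩

/-- **[FrdII] Theorem 2.4 (i) for the `p`-adic Frobenioids over GENERAL bases `Dᵢ = B^temp(Πᵢ, Πᵢ°)⁰` of §2 themselves**
(`Πᵢ → G_{ℚ_{pᵢ}}` ANY open homomorphisms). For `Ψ : C₁ ⥤ C₂` fully faithful, an object `A₁` with `(A₁)_D`, `(Ψ A₁)_D`
Galois, `μ_N(K̄ᵢ) ⊆ Lᵢ ≅ K_{Aᵢ}`, `A₁` `(N, H₁)`-saturated, any normalisation `F_N(A₁) ≅ ℤ/N`, and the printed inputs by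
name — "`Ψ` preserves `O^⊳(−)`" (`hO`), "`Ψ_Base` lies over `G₁ ⥲ G₂`" at `A₁` (`hbase`), the outer isomorphism
`G₁ ⥲ G₂` carrying `H₁` to `H₂` (`isoG`, `houter`, `map_H`), "`Φ₁` fieldwise saturated iff `Φ₂`" (`hfs`) — the typed
`Thm24i` holds for the contexts of `A₁`, `Ψ A₁`, the comparison data of the context isomorphism induced by `Ψ`, and the
cup-product duality isomorphisms: "`p₁ = p₂`", "`Ψ` maps `(N, H₁)`-saturated objects to `(N, H₂)`-saturated objects",
and the compatibility of the induced isomorphisms with the Kummer and reciprocity maps.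
[cite: MochizukiFrdII2008, Thm 2.4 (i) p.19] -/
theorem thm24i_ofFunctorRel (fs₁ fs₂ : Prop) (hfs : fs₁ ↔ fs₂)
    (eFN₁ : FN (contextOfObjectRel φ₁ hφ₁ d₁ hd₁ A₁ hA₁ H₁ hH₁) N ≃+ ZMod N)
    (hc₁ : IsNHSaturated (contextOfObjectRel φ₁ hφ₁ d₁ hd₁ A₁ hA₁ H₁ hH₁) N) :
    haveI := finiteDimensional_objL φ₁ hφ₁ d₁ A₁; haveI := normal_objL φ₁ hφ₁ d₁ A₁ hA₁
    haveI := finiteDimensional_objL φ₂ hφ₂ d₂ (F.obj A₁); haveI := normal_objL φ₂ hφ₂ d₂ (F.obj A₁) hA₂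
    haveI := finiteDimensional_baseFld p₁ φ₁ hφ₁; haveI := finiteDimensional_baseFld p₂ φ₂ hφ₂
    letI := (galoisChartRel φ₁ hφ₁ d₁ hd₁ A₁ hA₁).galAction
    letI := (galoisChartRel φ₂ hφ₂ d₂ hd₂ (F.obj A₁) hA₂).galAction
    Thm24i (contextOfObjectRel φ₁ hφ₁ d₁ hd₁ A₁ hA₁ H₁ hH₁) (contextOfObjectRel φ₂ hφ₂ d₂ hd₂ (F.obj A₁) hA₂ H₂ hH₂)
      N p₁ p₂ fs₁ fs₂
      ((isoOfFunctorRel hd₁ hd₂ F hA₁ hA₂ hO hbase isoG houter map_H).thm24Data N)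
      ((contextOfObjectRel φ₁ hφ₁ d₁ hd₁ A₁ hA₁ H₁ hH₁).dualityIsoOfLocalDuality N eFN₁ hc₁
        (cupDualH_bijective_ofGalois_mlf p₁ (objL φ₁ hφ₁ d₁ A₁) H₁ hH₁ (galoisChartRel φ₁ hφ₁ d₁ hd₁ A₁ hA₁).res
          (galoisChartRel φ₁ hφ₁ d₁ hd₁ A₁ hA₁).res_smul ((galoisChartRel φ₁ hφ₁ d₁ hd₁ A₁ hA₁).muModel N hμ₁)))
      ((contextOfObjectRel φ₂ hφ₂ d₂ hd₂ (F.obj A₁) hA₂ H₂ hH₂).dualityIsoOfLocalDuality N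
        (((isoOfFunctorRel hd₁ hd₂ F hA₁ hA₂ hO hbase isoG houter map_H).isoFN N).symm.trans eFN₁)
        (((isoOfFunctorRel hd₁ hd₂ F hA₁ hA₂ hO hbase isoG houter map_H).isNHSaturated_iff N).mp hc₁)
        (cupDualH_bijective_ofGalois_mlf p₂ (objL φ₂ hφ₂ d₂ (F.obj A₁)) H₂ hH₂
          (galoisChartRel φ₂ hφ₂ d₂ hd₂ (F.obj A₁) hA₂).res (galoisChartRel φ₂ hφ₂ d₂ hd₂ (F.obj A₁) hA₂).res_smul
          ((galoisChartRel φ₂ hφ₂ d₂ hd₂ (F.obj A₁) hA₂).muModel N hμ₂))) :=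
  thm24i_ofObjectsRel hd₁ hA₁ hd₂ hA₂ (isoOfFunctorRel hd₁ hd₂ F hA₁ hA₂ hO hbase isoG houter map_H) N hμ₁ hμ₂
    fs₁ fs₂ hfs eFN₁ hc₁

end PadicKummer.Def22Context

end Literature.AlgebraicGeometry.Frobenioids

end
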